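import Literature.MathematicalPhysics.QuantumFieldTheory.Federbush1986.PhaseCellIVIntrinsicMetric
import Literature.MathematicalPhysics.QuantumFieldTheory.Federbush1986.PhaseCellIVGaugeFormTargets

/-!
# Federbush, *A phase cell approach to Yang–Mills theory. IV. The choice of variables* (CMP **114** (1988) 317–343) —
# §11 (11.1), (11.5)–(11.6), Geometric Constructions 2 and 4 in the `d^g` form with `d` the INTRINSIC (bi-invariant
# Riemannian) distance of the gauge group `G`, the infimum in (11.1) over `u ∈ G` acting by left translation

statement-level skeleton of published theorems with citation tags; proofs where landed; nothing here is a claim about the Yang–Mills mass gap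

Cell `lit-balaban`, reader/typer block **r19** (F4 fold owner); SKELETON rows `F4.Def§11`, `F4.Eq11.4` of
`run/shared/lean/pub/lit-balaban/lit-balaban-r19/ROWS-F4.md` (cells only).

**Source.** P. Federbush, Commun. Math. Phys. **114** (1988) 317–343 [bib `Federbush1988PhaseCellIV`], §11 pp. 336–338:
«A gauge, `φ(x)`, on a set `𝓈 ⊂ R⁴` is defined as a mapping `φ : x → G`, `x ∈ 𝓈` …  If `φ₁` and `φ₂` are two such gauges defined
on `𝓈`, we set `d^g(φ₁, φ₂)` … to be `d^g(φ₁, φ₂) = Inf_{u∈G} sup_{x∈𝓈} d(uφ₁(x), φ₂(x))`» (11.1).  The `d` here is the distance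
ON THE GROUP `G`.  The tree proves (11.5)–(11.6) and Geometric Construction 4 in this `d^g` form at print's target `M = G`
(`PhaseCellIVGauge.gaugeForms_repTarget`, `gaugeForms_unitaryGroup`, `gaugeForms_specialUnitaryGroup`, p318774) with `d` read
as the chordal Frobenius (= Euclidean) distance of the embedded group `Ψ_F(G) ⊂ R^{2N²}` — the reviewer of p318774 noted
(remark 5) that print's `d` is the metric on `G`.  This file supplies the same statements with `d` the INTRINSIC distance of
`Ψ_F(G)` (`PhaseCellIVAppA.Intrinsic`, p319885), which for a compact matrix group with the Frobenius inner product is its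
bi-invariant Riemannian (geodesic) distance:

* §1 a `1`-Lipschitz map between subsets does not increase intrinsic distances (`intrinsicEDist_map_le`); hence a GROUP acting
  isometrically on `↥M` acts isometrically on `Intrinsic M` (instances `Intrinsic.instSMul`, `instMulAction`,
  `instIsIsometricSMul`), and continuously when `M` is uniformly Lipschitz-retractable (`Intrinsic.continuousSMul_of_retract`);
* §2 `GeomConstruction2GaugeLen Γ t M` / `GeomConstruction4GaugeLen Γ k t M` = the tree's `GeomConstruction2Gauge` /
  `GeomConstruction4Gauge` (p314251) with target `Intrinsic M` (so `d^g = gaugeDist Γ` and `Λ₁ = lipConst` are computed with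
  the intrinsic `d`), DERIVED from the intrinsic sup-distance forms `GeomConstruction2Len` / `GeomConstruction4Len` (p320191) for
  every compact group `Γ` acting isometrically and continuously (the mechanism `gauge_of_supDist_version` of p314251, restated
  for an arbitrary target);
* §3 RESULTS: `gaugeFormsLen_of_submanifold` (every compact `C^∞` submanifold `M ⊂ Rᵗ` with an isometric continuous action of
  a compact group), `gaugeFormsLen_repTarget` (print's target `M = Ψ_F(ρ(G))`, `G` any compact group acting by left translation,
  `ρ` any continuous unitary representation — hypothesis-free), `gaugeFormsLen_unitaryGroup`, `gaugeFormsLen_specialUnitaryGroup`.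

Not here: Geometric Constructions 5, 6 (cube versions of Theorems A.3/A.4; typed only, p314251).
-/

namespace Literature.MathematicalPhysics.QuantumFieldTheory.Federbush1986

noncomputable section

open scoped NNReal ENNReal unitInterval
open Set Metric

namespace PhaseCellIVAppA

/-! ## 1. Intrinsic distances under Lipschitz maps between subsets; group actions on `Intrinsic M` -/

section MapLe

variable {E E' : Type*} [PseudoEMetricSpace E] [PseudoEMetricSpace E'] {M : Set E} {M' : Set E'}

/-- A path in `E` with values in `M`, as a path in the subtype `↥M`. [cite: Federbush1988PhaseCellIV, Appendix A p. 339] -/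
def pathCodRestrict {x y : E} (γ : Path x y) (hγ : ∀ s, γ s ∈ M) :
    Path (⟨x, γ.source ▸ hγ 0⟩ : ↥M) ⟨y, γ.target ▸ hγ 1⟩ where
  toFun s := ⟨γ s, hγ s⟩
  continuous_toFun := γ.continuous.subtype_mk _
  source' := Subtype.ext γ.source
  target' := Subtype.ext γ.target

/-- Restricting the codomain does not change the length. [cite: Federbush1988PhaseCellIV, Appendix A p. 339] -/
theorem pathLength_pathCodRestrict {x y : E} (γ : Path x y) (hγ : ∀ s, γ s ∈ M) :
    pathLength (pathCodRestrict γ hγ) = pathLength γ := rfl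

/-- **A `1`-Lipschitz map `ψ : M → M′` (for the ambient distances) does not increase INTRINSIC distances**: the image of a path in
`M` is a path in `M′` of no greater length (print p. 339: mappings with «universally bounded differential»; here the bound is `1`).
[cite: Federbush1988PhaseCellIV, Appendix A p. 339; (11.1) p. 336] -/
theorem intrinsicEDist_map_le (ψ : ↥M → ↥M') (hψ : LipschitzWith 1 ψ) (x y : ↥M) :
    intrinsicEDist M' (ψ x : E') (ψ y : E') ≤ intrinsicEDist M (x : E) (y : E) := by
  refine le_iInf₂ fun γ hγ => ?_
  let γ' : Path x y := (pathCodRestrict γ hγ).cast (Subtype.ext rfl) (Subtype.ext rfl)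
  let δ : Path (ψ x : E') (ψ y : E') := (γ'.map hψ.continuous).map continuous_subtype_val
  have hδ : ∀ s, δ s ∈ M' := fun s => (ψ _).2
  calc intrinsicEDist M' (ψ x : E') (ψ y : E') ≤ pathLength δ := intrinsicEDist_le δ hδ
    _ ≤ 1 * pathLength (γ'.map hψ.continuous) := pathLength_map_le (LipschitzWith.subtype_val M') _
    _ ≤ 1 * (1 * pathLength γ') := by gcongr; exact pathLength_map_le hψ γ'
    _ = pathLength γ := by rw [one_mul, one_mul]; rfl

end MapLe

namespace Intrinsic

variable {E : Type*} [PseudoEMetricSpace E] {M : Set E} {Γ : Type*}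

/-- A group of transformations of `M` (print: `u ∈ G` acting on the gauge group `G` by left multiplication, (11.1)) acts on
the intrinsic copy `Intrinsic M` by the same maps. [cite: Federbush1988PhaseCellIV, (11.1) p. 336] -/
instance instSMul [SMul Γ ↥M] : SMul Γ (Intrinsic M) := ⟨fun g p => toIntrinsic M (g • ofIntrinsic M p)⟩

omit [PseudoEMetricSpace E] in
/-- Unfolding of the action. [cite: Federbush1988PhaseCellIV, (11.1) p. 336] -/
theorem smul_def [SMul Γ ↥M] (g : Γ) (p : Intrinsic M) : g • p = toIntrinsic M (g • ofIntrinsic M p) := rfl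

omit [PseudoEMetricSpace E] in
/-- `ofIntrinsic (g • p) = g • ofIntrinsic p`. [cite: Federbush1988PhaseCellIV, (11.1) p. 336] -/
@[simp] theorem ofIntrinsic_smul [SMul Γ ↥M] (g : Γ) (p : Intrinsic M) :
    ofIntrinsic M (g • p) = g • ofIntrinsic M p := rfl

/-- The action is a monoid action when it is one on `↥M`. [cite: Federbush1988PhaseCellIV, (11.1) p. 336] -/
instance instMulAction [Monoid Γ] [MulAction Γ ↥M] : MulAction Γ (Intrinsic M) where
  one_smul p := by
    change toIntrinsic M ((1 : Γ) • ofIntrinsic M p) = p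
    rw [one_smul]; rfl
  mul_smul g h p := by
    change toIntrinsic M ((g * h) • ofIntrinsic M p) = toIntrinsic M (g • (h • ofIntrinsic M p))
    rw [mul_smul]

/-- **A GROUP acting isometrically on `M` (ambient distances) acts isometrically on `(M, d)`** — the `u ∈ G` of (11.1) are
isometries of print's `d` on `G` (left translations of a bi-invariant metric). [cite: Federbush1988PhaseCellIV, (11.1) p. 336] -/
instance instIsIsometricSMul [Group Γ] [MulAction Γ ↥M] [IsIsometricSMul Γ ↥M] : IsIsometricSMul Γ (Intrinsic M) := by
  have hle : ∀ (g : Γ) (p q : Intrinsic M), edist (g • p) (g • q) ≤ edist p q := fun g p q =>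
    intrinsicEDist_map_le (fun a : ↥M => g • a) (isometry_smul (↥M) g).lipschitz (ofIntrinsic M p) (ofIntrinsic M q)
  refine ⟨fun g p q => le_antisymm (hle g p q) ?_⟩
  have h := hle g⁻¹ (g • p) (g • q)
  rwa [inv_smul_smul, inv_smul_smul] at h

variable {t : ℕ} {M : Set (EuclideanSpace ℝ (Fin t))} {r : ℝ} {L : ℝ≥0}
  {P : EuclideanSpace ℝ (Fin t) → EuclideanSpace ℝ (Fin t)}

/-- A jointly continuous action on `↥M` is jointly continuous on `(M, d)` when `M` is uniformly Lipschitz-retractable (the two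
topologies agree, `Intrinsic.homeomorphOfRetract`). [cite: Federbush1988PhaseCellIV, (11.1) p. 336; p. 342] -/
theorem continuousSMul_of_retract [TopologicalSpace Γ] [SMul Γ ↥M] [ContinuousSMul Γ ↥M] (hr : 0 < r)
    (hPL : LipschitzOnWith L P {w | infDist w M < r}) (hPM : MapsTo P {w | infDist w M < r} M) (hPid : ∀ w ∈ M, P w = w) :
    ContinuousSMul Γ (Intrinsic M) := by
  refine ⟨?_⟩
  change Continuous fun p : Γ × Intrinsic M => toIntrinsic M (p.1 • ofIntrinsic M p.2)
  have h1 : Continuous fun p : Γ × ↥M => p.1 • p.2 := continuous_smul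
  have h2 : Continuous (ofIntrinsic M) := continuous_ofIntrinsic
  have h3 : Continuous fun p : Γ × Intrinsic M => (p.1, ofIntrinsic M p.2) :=
    continuous_fst.prodMk (h2.comp continuous_snd)
  exact (continuous_toIntrinsic_of_retract hr hPL hPM hPid).comp (h1.comp h3)

end Intrinsic

/-! ## 2. (11.5)–(11.6) and Geometric Construction 4 in the `d^g` form with the intrinsic `d` -/

section GaugeForm

open Intrinsic PhaseCellIVGauge

variable (Γ : Type*) {t : ℕ}

/-- **Geometric Construction 2 with (11.1)'s `d^g`, INTRINSIC METRIC** — (11.5)–(11.6) p. 337: «a) `d^g(ᵉφ₁, ᵉφ₂) ≤ c d^g(φ₁, φ₂)`,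
(11.5) b) `Λ₁(ᵉφ₂) ≤ c(Λ₁(ᵉφ₁) + d^g(φ₁, φ₂)/L_r + Λ₁(φ₂))`, (11.6)» with `d^g(φ₁, φ₂) = Inf_{u∈G} sup_{x∈𝓈} d(uφ₁(x), φ₂(x))`
(11.1) — word for word the tree's `GeomConstruction2Gauge` (p314251) with the target `↥M` replaced by `Intrinsic M`: the `d`
inside `d^g` and `Λ₁` is the intrinsic distance of the group. `Prop`-valued definition.
[cite: Federbush1988PhaseCellIV, (11.5)–(11.6) p. 337; (11.1) p. 336] -/
def GeomConstruction2GaugeLen (t : ℕ) (M : Set (EuclideanSpace ℝ (Fin t))) [SMul Γ (Intrinsic M)] : Prop :=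
  ∃ ε : ℝ≥0, 0 < ε ∧ ∃ c : ℝ≥0, ∀ ℓ : ℝ, 0 < ℓ →
    ∀ (φ₁ φ₂ : ↥(sphere (0 : EuclideanSpace ℝ (Fin 1)) (ℓ / 2)) → Intrinsic M)
      (eφ₁ : ↥(closedBall (0 : EuclideanSpace ℝ (Fin 1)) (ℓ / 2)) → Intrinsic M),
      (∀ x : ↥(sphere (0 : EuclideanSpace ℝ (Fin 1)) (ℓ / 2)), eφ₁ ⟨x.1, sphere_subset_closedBall x.2⟩ = φ₁ x) →
      gaugeDist Γ φ₁ φ₂ ≤ ε →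
      ∃ eφ₂ : ↥(closedBall (0 : EuclideanSpace ℝ (Fin 1)) (ℓ / 2)) → Intrinsic M,
        (∀ x : ↥(sphere (0 : EuclideanSpace ℝ (Fin 1)) (ℓ / 2)), eφ₂ ⟨x.1, sphere_subset_closedBall x.2⟩ = φ₂ x) ∧
        gaugeDist Γ eφ₁ eφ₂ ≤ c * gaugeDist Γ φ₁ φ₂ ∧
        lipConst eφ₂ ≤ c * (lipConst eφ₁ + gaugeDist Γ φ₁ φ₂ / ENNReal.ofReal ℓ + lipConst φ₂)

/-- **Geometric Construction 4 with (11.1)'s `d^g`, INTRINSIC METRIC** (p. 338: «We extend `φ₂(x)` on `∂D` to `ᵉφ₂(x)` on `D`,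
satisfying (11.5) and (11.6)») — word for word `GeomConstruction4Gauge` (p314251) with target `Intrinsic M`. `Prop`-valued
definition. [cite: Federbush1988PhaseCellIV, Geometric Construction 4 p. 338; (11.1) p. 336] -/
def GeomConstruction4GaugeLen (k t : ℕ) (M : Set (EuclideanSpace ℝ (Fin t))) [SMul Γ (Intrinsic M)] : Prop :=
  ∃ ε : ℝ≥0, 0 < ε ∧ ∃ c : ℝ≥0,
    ∀ (φ₁ φ₂ : ↥(cubeBoundary k) → Intrinsic M) (eφ₁ : ↥(unitCube k) → Intrinsic M),
      (∀ x : ↥(cubeBoundary k), eφ₁ ⟨x.1, cubeBoundary_subset k x.2⟩ = φ₁ x) →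
      gaugeDist Γ φ₁ φ₂ ≤ ε →
      ∃ eφ₂ : ↥(unitCube k) → Intrinsic M,
        (∀ x : ↥(cubeBoundary k), eφ₂ ⟨x.1, cubeBoundary_subset k x.2⟩ = φ₂ x) ∧
        gaugeDist Γ eφ₁ eφ₂ ≤ c * gaugeDist Γ φ₁ φ₂ ∧
        lipConst eφ₂ ≤ c * (lipConst eφ₁ + gaugeDist Γ φ₁ φ₂ + lipConst φ₂)

variable {Γ}

/-- The mechanism of `PhaseCellIVGauge.gauge_of_supDist_version` (p314251) for an ARBITRARY target `Y` carrying an isometric,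
continuous action of a compact group: rotate `φ₁`, `ᵉφ₁` by the `u` attaining the infimum of (11.1), apply the sup-distance
statement, and use `d^g ≤ d^M`, `Λ₁(uφ) = Λ₁(φ)`. [cite: Federbush1988PhaseCellIV, (11.1) p. 336; (11.5)–(11.6) p. 337] -/
theorem gauge_of_supDist_version' {A B Y : Type*} [PseudoEMetricSpace A] [PseudoEMetricSpace B] [PseudoEMetricSpace Y]
    [Group Γ] [MulAction Γ Y] [IsIsometricSMul Γ Y] [TopologicalSpace Γ] [CompactSpace Γ] [ContinuousSMul Γ Y]
    (ι : A → B) {ε c : ℝ≥0} {D : ℝ≥0∞}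
    (h : ∀ (φ₁ φ₂ : A → Y) (eφ₁ : B → Y), (∀ x, eφ₁ (ι x) = φ₁ x) → supDist φ₁ φ₂ ≤ ε →
      ∃ eφ₂ : B → Y, (∀ x, eφ₂ (ι x) = φ₂ x) ∧ supDist eφ₁ eφ₂ ≤ c * supDist φ₁ φ₂ ∧
        lipConst eφ₂ ≤ c * (lipConst eφ₁ + supDist φ₁ φ₂ / D + lipConst φ₂))
    (φ₁ φ₂ : A → Y) (eφ₁ : B → Y) (hext : ∀ x, eφ₁ (ι x) = φ₁ x) (hε : gaugeDist Γ φ₁ φ₂ ≤ ε) :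
    ∃ eφ₂ : B → Y, (∀ x, eφ₂ (ι x) = φ₂ x) ∧ gaugeDist Γ eφ₁ eφ₂ ≤ c * gaugeDist Γ φ₁ φ₂ ∧
      lipConst eφ₂ ≤ c * (lipConst eφ₁ + gaugeDist Γ φ₁ φ₂ / D + lipConst φ₂) := by
  have : Nonempty Γ := ⟨1⟩
  obtain ⟨u, hu⟩ := exists_gaugeDist_eq (Γ := Γ) φ₁ φ₂
  obtain ⟨eφ₂, h1, h2, h3⟩ := h (u • φ₁) φ₂ (u • eφ₁) (fun x => by simp [Pi.smul_apply, hext x]) (hu ▸ hε)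
  refine ⟨eφ₂, h1, ?_, ?_⟩
  · exact (gaugeDist_le_supDist_smul u eφ₁ eφ₂).trans (hu ▸ h2)
  · rwa [lipConst_smul, ← hu] at h3

variable {M : Set (EuclideanSpace ℝ (Fin t))}

/-- **Construction 2 in the intrinsic `d^g` form from the intrinsic sup-distance form** (same `ε`, same `c`), for every compact
group acting isometrically and continuously on `(M, d)`. [cite: Federbush1988PhaseCellIV, (11.5)–(11.6) p. 337; (11.1) p. 336] -/
theorem GeomConstruction2Len.gauge [Group Γ] [MulAction Γ (Intrinsic M)] [IsIsometricSMul Γ (Intrinsic M)] [TopologicalSpace Γ]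
    [CompactSpace Γ] [ContinuousSMul Γ (Intrinsic M)] (h : GeomConstruction2Len t M) : GeomConstruction2GaugeLen Γ t M := by
  obtain ⟨ε, hε, c, hc⟩ := h
  refine ⟨ε, hε, c, fun ℓ hℓ φ₁ φ₂ eφ₁ hext hd => ?_⟩
  exact gauge_of_supDist_version' (fun x : ↥(sphere (0 : EuclideanSpace ℝ (Fin 1)) (ℓ / 2)) =>
    (⟨x.1, sphere_subset_closedBall x.2⟩ : ↥(closedBall (0 : EuclideanSpace ℝ (Fin 1)) (ℓ / 2)))) (hc ℓ hℓ) φ₁ φ₂ eφ₁ hext hd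

/-- **Construction 4 in the intrinsic `d^g` form from the intrinsic sup-distance form** (same `ε`, same `c`).
[cite: Federbush1988PhaseCellIV, Geometric Construction 4 p. 338; (11.1) p. 336] -/
theorem GeomConstruction4Len.gauge {k : ℕ} [Group Γ] [MulAction Γ (Intrinsic M)] [IsIsometricSMul Γ (Intrinsic M)]
    [TopologicalSpace Γ] [CompactSpace Γ] [ContinuousSMul Γ (Intrinsic M)] (h : GeomConstruction4Len k t M) :
    GeomConstruction4GaugeLen Γ k t M := by
  obtain ⟨ε, hε, c, hc⟩ := h
  refine ⟨ε, hε, c, fun φ₁ φ₂ eφ₁ hext hd => ?_⟩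
  have hc' := fun (φ₁ φ₂ : ↥(cubeBoundary k) → Intrinsic M) (eφ₁ : ↥(unitCube k) → Intrinsic M)
      (he : ∀ x : ↥(cubeBoundary k), eφ₁ ⟨x.1, cubeBoundary_subset k x.2⟩ = φ₁ x) (hs : supDist φ₁ φ₂ ≤ ε) =>
    show ∃ eφ₂ : ↥(unitCube k) → Intrinsic M, (∀ x : ↥(cubeBoundary k), eφ₂ ⟨x.1, cubeBoundary_subset k x.2⟩ = φ₂ x) ∧
        supDist eφ₁ eφ₂ ≤ c * supDist φ₁ φ₂ ∧ lipConst eφ₂ ≤ c * (lipConst eφ₁ + supDist φ₁ φ₂ / 1 + lipConst φ₂) by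
      simpa only [div_one] using hc φ₁ φ₂ eφ₁ he hs
  simpa only [div_one] using gauge_of_supDist_version'
    (fun x : ↥(cubeBoundary k) => (⟨x.1, cubeBoundary_subset k x.2⟩ : ↥(unitCube k))) hc' φ₁ φ₂ eφ₁ hext hd

end GaugeForm

/-! ## 3. Results: every compact `C^∞` submanifold with an isometric compact-group action; print's target `M = Ψ_F(ρ(G))` -/

section Results

open Intrinsic PhaseCellIVGauge Literature.AlgebraicGeometry.RealAlgebraic Literature.Analysis.Calculus

variable {Γ : Type*} {t : ℕ} {M : Set (EuclideanSpace ℝ (Fin t))}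

/-- **(11.5)–(11.6) and Construction 4 in the intrinsic `d^g` form for EVERY compact `C^∞` submanifold `M ⊂ Rᵗ`** carrying an
isometric (for the ambient distance), jointly continuous action of a compact group `Γ` — from `geomConstruction2Len_of_submanifold`
/ `geomConstruction4Len_of_submanifold` (p320191), the induced isometric action on `(M, d)` (§1) and the tubular retraction
(p299101, for the continuity of the action in the intrinsic topology).
[cite: Federbush1988PhaseCellIV, (11.5)–(11.6) p. 337; Geometric Construction 4 p. 338; (11.1) p. 336; p. 342] -/
theorem gaugeFormsLen_of_submanifold [Group Γ] [MulAction Γ ↥M] [IsIsometricSMul Γ ↥M] [TopologicalSpace Γ] [CompactSpace Γ]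
    [ContinuousSMul Γ ↥M] {d : ℕ} (hMc : IsCompact M) (hM : IsSubmanifoldOfDim d (EuclideanSpace.equiv (Fin t) ℝ '' M))
    (k : ℕ) : GeomConstruction2GaugeLen Γ t M ∧ GeomConstruction4GaugeLen Γ k t M := by
  by_cases hne : M.Nonempty
  · obtain ⟨r, hr, P, -, hPM, hPid, -, L, hPL⟩ := exists_smooth_retraction_euclidean hMc hne hM
    haveI : ContinuousSMul Γ (Intrinsic M) := continuousSMul_of_retract hr hPL (fun y hy => hPM y hy) hPid
    exact ⟨(geomConstruction2Len_of_submanifold hMc hM).gauge, (geomConstruction4Len_of_submanifold hMc hM k).gauge⟩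
  · haveI : IsEmpty (↥M) := isEmpty_coe_sort.2 (not_nonempty_iff_eq_empty.1 hne)
    haveI : IsEmpty (Intrinsic M) := ‹IsEmpty (↥M)›
    refine ⟨⟨1, one_pos, 1, fun ℓ hℓ φ₁ _ eφ₁ _ _ => ?_⟩, ⟨1, one_pos, 1, fun φ₁ φ₂ eφ₁ _ _ => ?_⟩⟩
    · exact isEmptyElim (eφ₁ ⟨0, mem_closedBall_self (by positivity)⟩)
    · by_cases hk : (unitCube k).Nonempty
      · obtain ⟨x, hx⟩ := hk
        exact isEmptyElim (eφ₁ ⟨x, hx⟩)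
      · refine ⟨eφ₁, fun x => absurd ⟨x.1, cubeBoundary_subset k x.2⟩ hk, ?_, ?_⟩
        · exact (gaugeDist_le_supDist eφ₁ eφ₁).trans ((supDist_self eφ₁).le.trans bot_le)
        · exact (iSup_le fun x => absurd ⟨x.1, x.2⟩ hk).trans bot_le

variable {N : ℕ} {G : Type*} [Group G] [TopologicalSpace G] [CompactSpace G]
  (ρ : ContinuousMonoidHom G (Matrix.unitaryGroup (Fin N) ℂ))

/-- **(11.5)–(11.6) (Geometric Construction 2) and Geometric Construction 4 WITH THE `d^g` OF (11.1) AND `d` THE INTRINSIC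
(bi-invariant Riemannian) DISTANCE OF THE GAUGE GROUP, `u ∈ G` acting by left translation — PROVED** for print's target
`M = Ψ_F(ρ(G))` (`PhaseCellIVGauge.repTarget ρ`, p318774), `G` any compact group, `ρ` any continuous unitary representation, every
cube dimension `k`; the submanifold structure of `ρ(G)` is [Hall2015] Cor. 3.45 (`isSubmanifoldOfDim_range_of_compact`, p302712).
[cite: Federbush1988PhaseCellIV, (11.1) p. 336; (11.5)–(11.6) p. 337; Geometric Construction 4 p. 338] -/
theorem gaugeFormsLen_repTarget (k : ℕ) :
    GeomConstruction2GaugeLen G (2 * N * N) (repTarget ρ) ∧ GeomConstruction4GaugeLen G k (2 * N * N) (repTarget ρ) := by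
  obtain ⟨𝔥, -, -, hE⟩ := isSubmanifoldOfDim_range_of_compact (valRep ρ) (continuous_valRep ρ)
  have hMc : IsCompact (repTarget ρ) := (isCompact_range (continuous_valRep ρ)).image (frobCoord N).continuous
  have hM : IsSubmanifoldOfDim (Module.finrank ℝ 𝔥) (EuclideanSpace.equiv (Fin (2 * N * N)) ℝ '' repTarget ρ) :=
    hE (frobCoord N)
  exact gaugeFormsLen_of_submanifold (M := repTarget ρ) hMc hM k

/-- The same for the gauge group `U(N)` acting on ITSELF by left translation — hypothesis-free, every `N`, every `k`.
[cite: Federbush1988PhaseCellIV, (11.1) p. 336; (11.5)–(11.6) p. 337; Geometric Construction 4 p. 338] -/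
theorem gaugeFormsLen_unitaryGroup (N k : ℕ) :
    GeomConstruction2GaugeLen (Matrix.unitaryGroup (Fin N) ℂ) (2 * N * N) (repTarget (unitaryRep N)) ∧
      GeomConstruction4GaugeLen (Matrix.unitaryGroup (Fin N) ℂ) k (2 * N * N) (repTarget (unitaryRep N)) :=
  gaugeFormsLen_repTarget (unitaryRep N) k

/-- … and for `SU(N)` acting on itself by left translation — hypothesis-free.
[cite: Federbush1988PhaseCellIV, (11.1) p. 336; (11.5)–(11.6) p. 337; Geometric Construction 4 p. 338] -/
theorem gaugeFormsLen_specialUnitaryGroup (N k : ℕ) :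
    GeomConstruction2GaugeLen (Matrix.specialUnitaryGroup (Fin N) ℂ) (2 * N * N) (repTarget (specialUnitaryRep N)) ∧
      GeomConstruction4GaugeLen (Matrix.specialUnitaryGroup (Fin N) ℂ) k (2 * N * N) (repTarget (specialUnitaryRep N)) :=
  gaugeFormsLen_repTarget (specialUnitaryRep N) k

end Results

end PhaseCellIVAppA

end

end Literature.MathematicalPhysics.QuantumFieldTheory.Federbush1986
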